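import Summits.ResolutionOfSingularities.ResolutionOfSingularities.Theorems.WeightedInvariantGradedSimpleOrbitChartsStable
import Literature.AlgebraicGeometry.Resolution.StrictNormalCrossingsFlatDescent
import Mathlib.Algebra.MonoidAlgebra.NoZeroDivisors
import Mathlib.Algebra.MonoidAlgebra.MapDomain
import HarnessLib

/-!
# The torus sweep of an open set of a graded chart is open and torus-stable; it swallows closed orbits

Route `ResolutionOfSingularities/WeightedInvariant`, door crux `HypersurfaceCentreConstruction`
(stmt-ResolutionOfSingularities-19897), e-ladder `e = 1` of `res-L1-w43-stub-10`, item **T-e1-L0 «orbit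
extension»** / `stub_e1_centre`, piece (P-b) part 3 (cell res-hironaka).  Parts 1–2
(`Theorems/WeightedInvariantGradedSimpleOrbitCharts{,Stable}.lean`) show that a torus-stable open containing
the generic point of a closed orbit with graded-simple chart ideal contains the orbit, chart by chart.  This
file supplies the torus-stable open that T-e1-L0 actually uses — the SWEEP `act(T × U)` of an open `U` of the
chart under the torus — in the graded encoding of the route (one affine chart `W ⊆ Y` with a `ℤʲ`-grading
`𝒜` of `A = Γ(Y, W)`, coaction `ρ : A → A[ℤʲ]` (`exists_coaction`), `act = Spec ρ ≫ (W ⊆ Y)` and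
`pr = Spec ι₀ ≫ (W ⊆ Y) : 𝔾ₘʲ × W → Y`):

* §1 algebra of the coaction: `single_zero_mem_of_forall_coaction_decompose_mem` (`ι₀ g = Σ_χ ρ(g_χ)·[−χ]`,
  so an ideal of `A[ℤʲ]` containing every `ρ(g_χ)` contains `ι₀ g`);
  `exists_isPrime_comap_coaction_eq` (over a prime `𝔭 ∌ g_χ` of `A` there is a prime `𝔮` of `A[ℤʲ]` with
  `ρ⁻¹ 𝔮 = 𝔭` and `ι₀ g ∉ 𝔮`: the contraction along the inverse shear `a[m] ↦ (Σ a_χ [−χ])·[m]` of the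
  prime `𝔭 · A[ℤʲ]`, which is prime because `(A ⧸ 𝔭)[ℤʲ]` is a domain);
* §2 points of the torus chart (`fromSpec_mem_basicOpen_iff`, `SpecMap_fromSpec_mem_basicOpen_iff`,
  `exists_fromSpec_eq`) and §3 **IMAGE FORMULA** `image_act_preimage_pr_basicOpen`: the sweep of a basic
  open is the union of the basic opens of the homogeneous components, `act(pr⁻¹ D(g)) = ⋃_χ D(g_χ)`;
* §3 for any open `U ⊆ Y`: `image_act_preimage_pr_eq_compl_zeroLocus` (the sweep `act(pr⁻¹ U)` is the
  complement of the zero set of the homogeneous components of the sections `g` with `D(g) ⊆ U`), hence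
  `isOpen_image_act_preimage_pr`, `image_act_preimage_pr_subset` (`⊆ W`), `inter_subset_image_act_preimage_pr`
  (`U ∩ W ⊆` sweep), and **STABILITY** `preimage_act_image_eq_preimage_pr_image`
  (`act⁻¹(sweep) = pr⁻¹(sweep)`, via part 2 `preimage_act_eq_preimage_pr_of_isHomogeneous` for the
  homogeneous span of the components);
* §4 **THE COVERING STEP OF T-e1-L0, single chart, hypotheses = `ELadderOne.Stage.Inv` (I2) at `η` on this
  chart verbatim**: `closure_inter_subset_image_act_of_gradedSimple` — `Y` locally Noetherian, `η ∈ U ∩ W`,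
  the prime `(W.2.primeIdealOf ⟨η, _⟩).asIdeal` of `η` in `Γ(Y, W)` homogeneous with graded-simple quotient
  ⇒ `closure {η} ∩ W ⊆ act(pr⁻¹ U)`: every point of the orbit closure inside the chart is swept by the torus
  from `U`.  Applied on a unit chart `a(y) ∋ y` of each `y ∈ 𝒬` (each such chart contains `η`), this is
  «the translates of `U` cover `𝒬`» with no density of rational torus points and no compatibility between
  the gradings of different charts (res-type-025's (I2)/(I2w) flag).

Pure scheme/graded-algebra plumbing; nothing here is a claim about Hironaka's problem and no statement of
H. Hironaka's manuscript is used.  AI-written; weaker than expert review.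
References: Włodarczyk arXiv:2203.03090 §2.3.1 [Wlodarczyk2022] (graded encoding of torus actions).
-/

noncomputable section

open CategoryTheory CategoryTheory.Limits AlgebraicGeometry TopologicalSpace
open Literature.AlgebraicGeometry.Resolution

set_option linter.dupNamespace false -- mandated namespace of this single-conjunct summit

namespace Summit.ResolutionOfSingularities.ResolutionOfSingularities.Theorems

universe u

/-! ## §1 Algebra of the coaction: primes of `A[M]` over a prime of `A` -/

section Algebra

open DatumToEmbedded.CentreHomogeneous AddMonoidAlgebra DirectSum

variable {M A σ : Type*} [DecidableEq M] [AddCommGroup M] [CommRing A] [SetLike σ A]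
  [AddSubgroupClass σ A] (𝒜 : M → σ) [GradedRing 𝒜]
  (ρ : A →+* A[M]) (hρ : ∀ (i : M) (a : A), a ∈ 𝒜 i → ρ a = single i a)
include hρ

/-- `ι₀ g = Σ_χ ρ(g_χ) · [−χ]`: an ideal of `A[M]` containing the coaction of every homogeneous component
of `g` contains `ι₀ g = g [0]`. [folklore] -/
theorem single_zero_mem_of_forall_coaction_decompose_mem (𝔮 : Ideal A[M]) (g : A)
    (h : ∀ χ, ρ (decompose 𝒜 g χ : A) ∈ 𝔮) : (single 0 g : A[M]) ∈ 𝔮 := by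
  classical
  have hsum : (single 0 g : A[M]) = ∑ χ ∈ (decompose 𝒜 g).support, single 0 (decompose 𝒜 g χ : A) := by
    rw [sum_single_zero, sum_support_decompose]
  rw [hsum]
  refine 𝔮.sum_mem fun χ _ => ?_
  have hmul : (single 0 (decompose 𝒜 g χ : A) : A[M]) =
      ρ (decompose 𝒜 g χ : A) * single (-χ) 1 := by
    rw [hρ χ _ (decompose 𝒜 g χ).2, single_mul_single, add_neg_cancel, mul_one]
  rw [hmul]
  exact 𝔮.mul_mem_right _ (h χ)

/-- Contrapositive: if `ι₀ g ∉ 𝔮` then some `ρ(g_χ) ∉ 𝔮`. [folklore] -/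
theorem exists_coaction_decompose_notMem {𝔮 : Ideal A[M]} {g : A} (hg : (single 0 g : A[M]) ∉ 𝔮) :
    ∃ χ, ρ (decompose 𝒜 g χ : A) ∉ 𝔮 := by
  by_contra h
  push Not at h
  exact hg (single_zero_mem_of_forall_coaction_decompose_mem 𝒜 ρ hρ 𝔮 g h)

omit hρ in
/-- Coefficients of a twisted coaction: if `ρ' a = a [ε i]` for `a ∈ 𝒜 i` with `ε` injective, then the
coefficient of `ρ' a` at `ε i` is the homogeneous component `a_i`. [folklore] -/
theorem coeff_twistedCoaction {ρ' : A →+* A[M]} {ε : M → M} (hε : Function.Injective ε)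
    (hρ' : ∀ (i : M) (a : A), a ∈ 𝒜 i → ρ' a = single (ε i) a) (a : A) (i : M) :
    (ρ' a).coeff (ε i) = decompose 𝒜 a i := by
  induction a using Decomposition.inductionOn 𝒜 with
  | zero => simp
  | @homogeneous j x =>
    rw [hρ' j x x.2, coeff_single]
    obtain rfl | h := eq_or_ne j i
    · rw [Finsupp.single_eq_same, decompose_of_mem_same 𝒜 x.2]
    · rw [Finsupp.single_eq_of_ne (hε.ne h).symm, decompose_of_mem_ne 𝒜 x.2 h]
  | add a b ha hb => simp [ha, hb]

omit [DecidableEq M] [GradedRing 𝒜] hρ in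
/-- The extension `𝔭 · A[M]` of a prime `𝔭 ≤ A` — realised as the kernel of `A[M] → (A ⧸ 𝔭)[M]` — is prime
when `M` has unique sums (e.g. `M = ℤʲ`): `(A ⧸ 𝔭)[M]` is a domain. [folklore] -/
theorem ker_mapRingHom_quotient_isPrime [UniqueSums M] (𝔭 : Ideal A) [𝔭.IsPrime] :
    (RingHom.ker (mapRingHom M (Ideal.Quotient.mk 𝔭) : A[M] →+* (A ⧸ 𝔭)[M])).IsPrime :=
  RingHom.ker_isPrime _

/-- **Primes of the torus chart over a prime of the base, avoiding `ι₀ g`.**  Let `𝔭` be a prime of `A` not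
containing the homogeneous component `g_χ` of `g`.  Then there is a prime `𝔮` of `A[M]` (`M` with unique
sums) with `ρ⁻¹ 𝔮 = 𝔭` and `ι₀ g ∉ 𝔮`: the contraction of `𝔭 · A[M]` along the inverse shear
`a [m] ↦ (Σ_χ a_χ [−χ]) · [m]`, which carries `ρ a` to `a [0]` and `g [0]` to `Σ_χ g_χ [−χ]`.  Geometrically:
the point `𝔭` of `D(g_χ) ⊆ Spec A` is swept by the torus from `D(g)`. [folklore] -/
theorem exists_isPrime_comap_coaction_eq [UniqueSums M] (𝔭 : Ideal A) [𝔭.IsPrime] (g : A) (χ : M)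
    (hg : (decompose 𝒜 g χ : A) ∉ 𝔭) :
    ∃ 𝔮 : Ideal A[M], 𝔮.IsPrime ∧ 𝔮.comap ρ = 𝔭 ∧ (single 0 g : A[M]) ∉ 𝔮 := by
  classical
  -- the antipode-twisted coaction `ρ' a = Σ a_χ [-χ]` and the inverse shear `σ`
  let ρ' : A →+* A[M] := (mapDomainRingHom A (negAddMonoidHom : M →+ M)).comp ρ
  have hρ' : ∀ (i : M) (a : A), a ∈ 𝒜 i → ρ' a = single (-i) a := fun i a h => by
    simp [ρ', hρ i a h, mapDomain_single]
  let σ : A[M] →+* A[M] := liftNCRingHom ρ' (AddMonoidAlgebra.of A M) fun _ _ => Commute.all _ _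
  have hσρ : ∀ b : A, σ (ρ b) = single 0 b := by
    intro b
    conv_lhs => rw [← sum_support_decompose 𝒜 b]
    conv_rhs => rw [← sum_support_decompose 𝒜 b]
    rw [map_sum, map_sum, ← sum_single_zero]
    refine Finset.sum_congr rfl fun i _ => ?_
    rw [hρ i _ (decompose 𝒜 b i).2, liftNCRingHom_of_single, hρ' i _ (decompose 𝒜 b i).2,
      single_mul_single, neg_add_cancel, mul_one]
  have hσ0 : ∀ b : A, σ (single 0 b) = ρ' b := by
    intro b
    rw [liftNCRingHom_of_single, ← AddMonoidAlgebra.one_def, mul_one]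
  -- the prime `𝔭 · A[M]` as a kernel, and its contraction along `σ`
  let π : A[M] →+* (A ⧸ 𝔭)[M] := mapRingHom M (Ideal.Quotient.mk 𝔭)
  haveI : (RingHom.ker π).IsPrime := RingHom.ker_isPrime _
  refine ⟨(RingHom.ker π).comap σ, Ideal.comap_isPrime σ _, ?_, ?_⟩
  · ext b
    rw [Ideal.mem_comap, Ideal.mem_comap, RingHom.mem_ker, hσρ]
    change π (single 0 b) = 0 ↔ b ∈ 𝔭
    rw [show π (single 0 b) = single 0 (Ideal.Quotient.mk 𝔭 b) from mapRingHom_single _ _ _,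
      single_eq_zero, Ideal.Quotient.eq_zero_iff_mem]
  · rw [Ideal.mem_comap, RingHom.mem_ker, hσ0]
    intro hzero
    have hcoeff := congrArg (fun x : (A ⧸ 𝔭)[M] => x.coeff (-χ)) hzero
    simp only [π, coeff_mapRingHom] at hcoeff
    rw [coeff_twistedCoaction 𝒜 neg_injective hρ' g χ] at hcoeff
    exact hg (Ideal.Quotient.eq_zero_iff_mem.mp (by simpa using hcoeff))

end Algebra

/-! ## §2 Points of the torus chart: membership in basic opens -/

section Points

variable {Y : Scheme.{u}} (W : Y.affineOpens)

/-- `fromSpec p ∈ D(g) ↔ g ∉ p` for the structure map `Spec Γ(Y, W) → Y` of an affine open. [folklore] -/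
theorem fromSpec_mem_basicOpen_iff (g : Γ(Y, W)) (p : Spec Γ(Y, W)) :
    W.2.fromSpec p ∈ Y.basicOpen g ↔ g ∉ p.asIdeal := by
  have h := Set.ext_iff.mp (W.2.fromSpec_preimage_zeroLocus ({g} : Set Γ(Y, W))) p
  rw [Set.mem_preimage, Scheme.zeroLocus_singleton, Set.mem_compl_iff, SetLike.mem_coe] at h
  -- `h : fromSpec p ∉ D(g) ↔ p ∈ V({g})`, and `p ∈ V({g}) ↔ g ∈ p`
  have h2 : p ∈ PrimeSpectrum.zeroLocus ({g} : Set Γ(Y, W)) ↔ g ∈ p.asIdeal :=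
    ⟨fun hp => hp (Set.mem_singleton g), fun hg => Set.singleton_subset_iff.mpr hg⟩
  constructor
  · exact fun hmem hg => (h.mpr (h2.mpr hg)) hmem
  · intro hng
    by_contra hmem
    exact hng (h2.mp (h.mp hmem))

/-- `(Spec φ ≫ fromSpec) x ∈ D(g) ↔ φ g ∉ x` for `Spec R → Spec Γ(Y, W) → Y`. [folklore] -/
theorem SpecMap_fromSpec_mem_basicOpen_iff {R : CommRingCat.{u}} (φ : Γ(Y, W) ⟶ R) (g : Γ(Y, W))
    (x : Spec R) : (Spec.map φ ≫ W.2.fromSpec) x ∈ Y.basicOpen g ↔ φ.hom g ∉ x.asIdeal := by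
  rw [Scheme.Hom.comp_apply, fromSpec_mem_basicOpen_iff, Spec.map_apply]
  exact Iff.rfl

/-- Every point of `W` is `fromSpec p` for a point `p` of `Spec Γ(Y, W)`. [folklore] -/
theorem exists_fromSpec_eq {y : Y} (hy : y ∈ (W : Set Y)) : ∃ p : Spec Γ(Y, W), W.2.fromSpec p = y := by
  rw [← IsAffineOpen.range_fromSpec W.2] at hy
  exact hy

end Points

/-! ## §3 The sweep of an open set of a graded chart -/

section Sweep

open DatumToEmbedded.CentreHomogeneous AddMonoidAlgebra DirectSum Scheme.IdealSheafData

variable {Y : Scheme.{u}} {j : ℕ} (W : Y.affineOpens) (𝒜 : (Fin j → ℤ) → AddSubgroup Γ(Y, W)) [GradedRing 𝒜]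
  (ρ : (Γ(Y, W) : Type u) →+* (Γ(Y, W) : Type u)[Fin j → ℤ])
  (hρ : ∀ (i : Fin j → ℤ) (a : Γ(Y, W)), a ∈ 𝒜 i → ρ a = single i a)

include hρ

/-- **Image formula**: the torus sweep of a basic open of the chart is the union of the basic opens of the
homogeneous components, `act(pr⁻¹ D(g)) = ⋃_χ D(g_χ)` (as subsets of `Y`). [folklore] -/
theorem image_act_preimage_pr_basicOpen (g : Γ(Y, W)) :
    (Spec.map (CommRingCat.ofHom ρ) ≫ W.2.fromSpec) ''
        ((Spec.map (CommRingCat.ofHom (singleZeroRingHom : Γ(Y, W) →+* (Γ(Y, W) : Type u)[Fin j → ℤ])) ≫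
          W.2.fromSpec) ⁻¹' (Y.basicOpen g : Set Y)) =
      ⋃ χ, (Y.basicOpen (decompose 𝒜 g χ : Γ(Y, W)) : Set Y) := by
  ext y
  simp only [Set.mem_image, Set.mem_preimage, Set.mem_iUnion, SetLike.mem_coe]
  constructor
  · rintro ⟨z, hz, rfl⟩
    rw [SpecMap_fromSpec_mem_basicOpen_iff, CommRingCat.hom_ofHom, singleZeroRingHom_eq] at hz
    obtain ⟨χ, hχ⟩ := exists_coaction_decompose_notMem 𝒜 ρ hρ (𝔮 := z.asIdeal) hz
    refine ⟨χ, ?_⟩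
    rw [SpecMap_fromSpec_mem_basicOpen_iff, CommRingCat.hom_ofHom]
    exact hχ
  · rintro ⟨χ, hχ⟩
    obtain ⟨p, rfl⟩ := exists_fromSpec_eq W (Y.basicOpen_le _ hχ)
    rw [fromSpec_mem_basicOpen_iff] at hχ
    haveI : p.asIdeal.IsPrime := p.isPrime
    obtain ⟨𝔮, h𝔮, hcomap, hg⟩ := exists_isPrime_comap_coaction_eq 𝒜 ρ hρ p.asIdeal g χ hχ
    refine ⟨⟨𝔮, h𝔮⟩, ?_, ?_⟩
    · rw [SpecMap_fromSpec_mem_basicOpen_iff, CommRingCat.hom_ofHom, singleZeroRingHom_eq]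
      exact hg
    · rw [Scheme.Hom.comp_apply]
      congr 1
      rw [Spec.map_apply]
      apply PrimeSpectrum.ext
      change Ideal.comap (CommRingCat.ofHom ρ).hom 𝔮 = p.asIdeal
      rw [CommRingCat.hom_ofHom]
      exact hcomap

/-- **The sweep of an open set is the complement of a homogeneous zero set**: for an open `U ⊆ Y`,
`act(pr⁻¹ U) = Y ∖ V(S)` with `S` the set of homogeneous components of the sections `g ∈ Γ(Y, W)` with
`D(g) ⊆ U` (the basic opens of the affine `W` inside `U` cover `U ∩ W`). [folklore] -/
theorem image_act_preimage_pr_eq_compl_zeroLocus (U : Y.Opens) :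
    (Spec.map (CommRingCat.ofHom ρ) ≫ W.2.fromSpec) ''
        ((Spec.map (CommRingCat.ofHom (singleZeroRingHom : Γ(Y, W) →+* (Γ(Y, W) : Type u)[Fin j → ℤ])) ≫
          W.2.fromSpec) ⁻¹' (U : Set Y)) =
      (Y.zeroLocus (U := W) {s | ∃ (g : Γ(Y, W)) (χ : Fin j → ℤ),
        Y.basicOpen g ≤ U ∧ s = (decompose 𝒜 g χ : Γ(Y, W))})ᶜ := by
  set act := Spec.map (CommRingCat.ofHom ρ) ≫ W.2.fromSpec with hact
  set pr := Spec.map (CommRingCat.ofHom (singleZeroRingHom : Γ(Y, W) →+* (Γ(Y, W) : Type u)[Fin j → ℤ])) ≫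
    W.2.fromSpec with hpr
  -- `U ∩ W` is the union of the basic opens `D(g) ⊆ U`, and `pr` lands in `W`
  have hU : pr ⁻¹' (U : Set Y) = ⋃ g ∈ {g : Γ(Y, W) | Y.basicOpen g ≤ U}, pr ⁻¹' (Y.basicOpen g : Set Y) := by
    ext z
    simp only [Set.mem_preimage, Set.mem_iUnion, Set.mem_setOf_eq, exists_prop]
    constructor
    · intro hz
      have hzW : pr z ∈ (W : Set Y) := SpecMap_fromSpec_apply_mem W _ z
      obtain ⟨g, hgU, hzg⟩ := W.2.exists_basicOpen_le ⟨pr z, hz⟩ hzW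
      exact ⟨g, hgU, hzg⟩
    · rintro ⟨g, hgU, hzg⟩
      exact hgU hzg
  rw [hU, Set.image_iUnion₂]
  simp only [hact, hpr, image_act_preimage_pr_basicOpen W 𝒜 ρ hρ]
  -- both sides are the union of the `D(g_χ)`
  rw [Scheme.zeroLocus_def, Set.compl_iInter₂]
  ext y
  simp only [Set.mem_iUnion, Set.mem_setOf_eq, exists_prop, compl_compl]
  constructor
  · rintro ⟨g, hgU, χ, hy⟩
    exact ⟨_, ⟨g, χ, hgU, rfl⟩, hy⟩
  · rintro ⟨s, ⟨g, χ, hgU, rfl⟩, hy⟩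
    exact ⟨g, hgU, χ, hy⟩

/-- The sweep `act(pr⁻¹ U)` of an open set is OPEN. [folklore] -/
theorem isOpen_image_act_preimage_pr (U : Y.Opens) :
    IsOpen ((Spec.map (CommRingCat.ofHom ρ) ≫ W.2.fromSpec) ''
        ((Spec.map (CommRingCat.ofHom (singleZeroRingHom : Γ(Y, W) →+* (Γ(Y, W) : Type u)[Fin j → ℤ])) ≫
          W.2.fromSpec) ⁻¹' (U : Set Y))) := by
  rw [image_act_preimage_pr_eq_compl_zeroLocus W 𝒜 ρ hρ U]
  exact (Y.zeroLocus_isClosed _).isOpen_compl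

omit hρ in
/-- The sweep `act(pr⁻¹ U)` lies in the chart `W`. [folklore] -/
theorem image_act_preimage_pr_subset (U : Y.Opens) :
    (Spec.map (CommRingCat.ofHom ρ) ≫ W.2.fromSpec) ''
        ((Spec.map (CommRingCat.ofHom (singleZeroRingHom : Γ(Y, W) →+* (Γ(Y, W) : Type u)[Fin j → ℤ])) ≫
          W.2.fromSpec) ⁻¹' (U : Set Y)) ⊆ (W : Set Y) := by
  rintro _ ⟨z, -, rfl⟩
  exact SpecMap_fromSpec_apply_mem W _ z

/-- The sweep `act(pr⁻¹ U)` contains `U ∩ W` (a point of `D(g)` lies in some `D(g_χ)`). [folklore] -/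
theorem inter_subset_image_act_preimage_pr (U : Y.Opens) :
    (U : Set Y) ∩ W ⊆ (Spec.map (CommRingCat.ofHom ρ) ≫ W.2.fromSpec) ''
        ((Spec.map (CommRingCat.ofHom (singleZeroRingHom : Γ(Y, W) →+* (Γ(Y, W) : Type u)[Fin j → ℤ])) ≫
          W.2.fromSpec) ⁻¹' (U : Set Y)) := by
  classical
  rw [image_act_preimage_pr_eq_compl_zeroLocus W 𝒜 ρ hρ U]
  rintro y ⟨hyU, hyW⟩ hyZ
  obtain ⟨g, hgU, hyg⟩ := W.2.exists_basicOpen_le ⟨y, hyU⟩ hyW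
  -- `g = Σ g_χ` lies in the span of its components, all of which vanish at `y`
  have hspan : g ∈ Ideal.span {s | ∃ (g : Γ(Y, W)) (χ : Fin j → ℤ),
      Y.basicOpen g ≤ U ∧ s = (decompose 𝒜 g χ : Γ(Y, W))} := by
    rw [← sum_support_decompose 𝒜 g]
    exact Ideal.sum_mem _ fun χ _ => Ideal.subset_span ⟨g, χ, hgU, rfl⟩
  have hyZ' : y ∈ Y.zeroLocus (U := W) (Ideal.span {s | ∃ (g : Γ(Y, W)) (χ : Fin j → ℤ),
      Y.basicOpen g ≤ U ∧ s = (decompose 𝒜 g χ : Γ(Y, W))} : Set Γ(Y, W)) := by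
    rwa [Scheme.zeroLocus_span]
  exact (Y.mem_zeroLocus_iff _ y).mp hyZ' g hspan hyg

/-- **STABILITY: the sweep of an open set is torus-stable**, `act⁻¹(act(pr⁻¹ U)) = pr⁻¹(act(pr⁻¹ U))` —
its complement in `W` is the zero set of a HOMOGENEOUS ideal (spanned by homogeneous components), to which
`preimage_act_eq_preimage_pr_of_isHomogeneous` applies. [folklore] -/
theorem preimage_act_image_eq_preimage_pr_image (U : Y.Opens) :
    (Spec.map (CommRingCat.ofHom ρ) ≫ W.2.fromSpec) ⁻¹'
        ((Spec.map (CommRingCat.ofHom ρ) ≫ W.2.fromSpec) ''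
          ((Spec.map (CommRingCat.ofHom (singleZeroRingHom : Γ(Y, W) →+* (Γ(Y, W) : Type u)[Fin j → ℤ])) ≫
            W.2.fromSpec) ⁻¹' (U : Set Y))) =
      (Spec.map (CommRingCat.ofHom (singleZeroRingHom : Γ(Y, W) →+* (Γ(Y, W) : Type u)[Fin j → ℤ])) ≫
          W.2.fromSpec) ⁻¹'
        ((Spec.map (CommRingCat.ofHom ρ) ≫ W.2.fromSpec) ''
          ((Spec.map (CommRingCat.ofHom (singleZeroRingHom : Γ(Y, W) →+* (Γ(Y, W) : Type u)[Fin j → ℤ])) ≫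
            W.2.fromSpec) ⁻¹' (U : Set Y))) := by
  rw [image_act_preimage_pr_eq_compl_zeroLocus W 𝒜 ρ hρ U, Set.preimage_compl, Set.preimage_compl,
    ← Scheme.zeroLocus_span]
  have hhom : (Ideal.span {s | ∃ (g : Γ(Y, W)) (χ : Fin j → ℤ),
      Y.basicOpen g ≤ U ∧ s = (decompose 𝒜 g χ : Γ(Y, W))}).IsHomogeneous 𝒜 :=
    Ideal.homogeneous_span 𝒜 _ fun s ⟨g, χ, _, hs⟩ => hs ▸ ⟨χ, (decompose 𝒜 g χ).2⟩
  rw [preimage_act_eq_preimage_pr_of_isHomogeneous W 𝒜 ρ hρ hhom]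

/-! ## §4 The covering step of T-e1-L0 on one chart -/

/-- **The torus sweep of a neighbourhood of `η` swallows the orbit closure inside the chart.**  Let `Y` be
locally Noetherian, `W ⊆ Y` an affine chart with a `ℤʲ`-grading `𝒜` of `Γ(Y, W)` and coaction `ρ`, and
`η ∈ U ∩ W` (`U` open) a point whose prime `𝔭_η ≤ Γ(Y, W)` is HOMOGENEOUS with GRADED-SIMPLE quotient
(= `ELadderOne.Stage.Inv` (I2) at `η` on this chart: the chart meets `cl{η}` in a closed torus orbit with
finite stabilisers).  Then `cl{η} ∩ W ⊆ act(pr⁻¹ U)`: the sweep is a torus-stable open (§3) containing `η`,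
so `cl{η} ∖ sweep` is a torus-stable closed subset of `cl{η}` missing `η`, whose chart ideal is homogeneous
(part 2) and hence, by graded-simplicity, all of `Γ(Y, W)` (part 1). [folklore] -/
theorem closure_inter_subset_image_act_of_gradedSimple [IsLocallyNoetherian Y] (U : Y.Opens) {η : Y}
    (hηU : η ∈ U) (hηW : η ∈ (W : Y.Opens))
    (hhom : ((W.2.primeIdealOf ⟨η, hηW⟩).asIdeal).IsHomogeneous 𝒜)
    (hsimple : ∀ (i : Fin j → ℤ) ⦃s : Γ(Y, W)⦄, s ∈ 𝒜 i → s ∉ (W.2.primeIdealOf ⟨η, hηW⟩).asIdeal →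
      IsUnit (Ideal.Quotient.mk (W.2.primeIdealOf ⟨η, hηW⟩).asIdeal s)) :
    closure ({η} : Set Y) ∩ W ⊆ (Spec.map (CommRingCat.ofHom ρ) ≫ W.2.fromSpec) ''
        ((Spec.map (CommRingCat.ofHom (singleZeroRingHom : Γ(Y, W) →+* (Γ(Y, W) : Type u)[Fin j → ℤ])) ≫
          W.2.fromSpec) ⁻¹' (U : Set Y)) := by
  -- the sweep as an open of `Y`
  let Ω : Y.Opens := ⟨_, isOpen_image_act_preimage_pr W 𝒜 ρ hρ U⟩
  have hΩ : (Ω : Set Y) = (Spec.map (CommRingCat.ofHom ρ) ≫ W.2.fromSpec) ''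
      ((Spec.map (CommRingCat.ofHom (singleZeroRingHom : Γ(Y, W) →+* (Γ(Y, W) : Type u)[Fin j → ℤ])) ≫
        W.2.fromSpec) ⁻¹' (U : Set Y)) := rfl
  let Z : Closeds Y := ⟨closure {η}, isClosed_closure⟩
  have hZW : (vanishingIdeal Z).ideal W = (W.2.primeIdealOf ⟨η, hηW⟩).asIdeal := vanishingIdeal_closure_ideal W hηW
  have hηΩ : η ∈ (Ω : Set Y) := by
    rw [hΩ]
    exact inter_subset_image_act_preimage_pr W 𝒜 ρ hρ U ⟨hηU, hηW⟩
  have hstab := preimage_act_image_eq_preimage_pr_image W 𝒜 ρ hρ U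
  have hC : ((vanishingIdeal (Z ⊓ Ω.compl)).ideal W).IsHomogeneous 𝒜 :=
    vanishingIdeal_inf_compl_isHomogeneous W 𝒜 ρ hρ Z (hZW ▸ hhom) Ω (by rw [hΩ]; exact hstab)
  have hP : ∀ (i : Fin j → ℤ) ⦃s : Γ(Y, W)⦄, s ∈ 𝒜 i → s ∉ (vanishingIdeal Z).ideal W →
      IsUnit (Ideal.Quotient.mk ((vanishingIdeal Z).ideal W) s) := by
    rw [hZW]; exact hsimple
  have hempty := closeds_inter_eq_empty_of_gradedSimple_of_not_mem' W 𝒜 (Z ⊓ Ω.compl) Z inf_le_left hP hC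
    hηW (subset_closure (Set.mem_singleton η))
    (fun h => by
      rw [← SetLike.mem_coe, Closeds.coe_inf, Opens.coe_compl] at h
      exact h.2 hηΩ)
  intro y hy
  rw [← hΩ]
  by_contra hyΩ
  have hyC : y ∈ ((Z ⊓ Ω.compl : Closeds Y) : Set Y) ∩ W := by
    rw [Closeds.coe_inf, Opens.coe_compl]
    exact ⟨⟨hy.1, hyΩ⟩, hy.2⟩
  rw [hempty] at hyC
  exact hyC

end Sweep

end Summit.ResolutionOfSingularities.ResolutionOfSingularities.Theorems

end
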